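import Mathlib.Data.Nat.Choose.Basic
import Summits.CriticalPhenomena.PercolationContinuityZ3.Theorems.PercNearOneGluingNoHeavyLowerTailSahiCTCKleitmanSurplus
import HarnessLib

/-!
# `NoHeavyLowerTail` (crux stmt-CriticalPhenomena-4575), P3 lane: the TRIANGLE and DEGREE lemmas for the Kleitman surplus of two 2-live up-sets
# restricted to a finset (memo g25 §2)

Support file (seat `prim-l12-p3`, gen 25; `--supports stmt-CriticalPhenomena-4575`).  Continues `…SahiCTCKleitmanSurplus` (`tr`, `kap`, pair formula,
vertex recursion, LOOP lemma).  Here `𝒳, 𝒵` are up-sets all of whose members have ≥ 2 elements ("2-live"), the cube has empty base (so the traces are the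
restrictions `𝒳 ∩ 2^s`, `𝒵 ∩ 2^s`); `cedges 𝒳 𝒵 s` = common 2-element members inside `s`, `cnbrs 𝒳 𝒵 s v` = common neighbours of `v` inside `s`:
* `kap_empty_eq_card_of_card_le_three` : on ≤ 3 points `κ = #(common members)`;
* `card_add_one_le_kap_of_triangle` (TRIANGLE): a common triangle forces `κ ≥ #s + 1`;
* `card_cnbrs_add_one_le_kap` (DEGREE): `κ ≥ 1 + (common degree of v)` when that degree is ≥ 1 and `#s ≥ 3` (induction on `#s` via the vertex
  recursion; the core `card_le_kap_of_adjacent_all` is the pair-formula count of the memo).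
The DENSITY lemma is in `…SahiCTCKleitmanDensity`.  Nothing is asserted about the crux.
-/

namespace Summit.CriticalPhenomena.PercolationContinuityZ3.Theorems.SahiCTCForms

open Finset

variable {α : Type*} [DecidableEq α]

/-- The common 2-element members of `𝒳, 𝒵` inside `s` (the common-edge graph on `s`). [this work] -/
def cedges (𝒳 𝒵 : Finset (Finset α)) (s : Finset α) : Finset (Finset α) :=
  s.powerset.filter fun e => #e = 2 ∧ e ∈ 𝒳 ∧ e ∈ 𝒵

/-- The common neighbours of `v` inside `s`: `{u ∈ s − v : {v,u} ∈ 𝒳 ∩ 𝒵}`. [this work] -/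
def cnbrs (𝒳 𝒵 : Finset (Finset α)) (s : Finset α) (v : α) : Finset α :=
  (s.erase v).filter fun u => ({v, u} : Finset α) ∈ 𝒳 ∧ ({v, u} : Finset α) ∈ 𝒵

section TwoLive
variable {𝒳 𝒵 : Finset (Finset α)} {s : Finset α}

/-- Members of the restriction of a 2-live family have ≥ 2 elements; in particular the complement pair count vanishes on ≤ 3 points. [this work] -/
theorem filter_compl_eq_empty_of_card_le_three (hX2 : ∀ U ∈ 𝒳, 2 ≤ #U) (hZ2 : ∀ U ∈ 𝒵, 2 ≤ #U) (hs : #s ≤ 3) :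
    ((tr 𝒳 ∅ s).filter fun U => s \ U ∈ tr 𝒵 ∅ s) = ∅ := by
  refine filter_eq_empty_iff.2 fun U hU h => ?_
  obtain ⟨hUs, hUX⟩ := mem_tr_empty.1 hU
  obtain ⟨_, hUZ⟩ := mem_tr_empty.1 h
  have h1 := hX2 U hUX
  have h2 := hZ2 _ hUZ
  have h3 : #(s \ U) = #s - #U := card_sdiff_of_subset hUs
  have h4 : #U ≤ #s := card_le_card hUs
  omega

/-- On at most three points `κ` of two 2-live families is the number of common members inside `s`. [this work] -/
theorem kap_empty_eq_card_of_card_le_three (hX2 : ∀ U ∈ 𝒳, 2 ≤ #U) (hZ2 : ∀ U ∈ 𝒵, 2 ≤ #U) (hs : #s ≤ 3) :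
    kap 𝒳 𝒵 ∅ s = #(tr 𝒳 ∅ s ∩ tr 𝒵 ∅ s) := by
  unfold kap; rw [filter_compl_eq_empty_of_card_le_three hX2 hZ2 hs, card_empty, Nat.cast_zero, sub_zero]

/-- For 2-live up-sets there are no 'negative pairs' once one of `U`, `s \ U` is forced into both families; here: a common TRIANGLE `xyz`
forces every complementary pair to contain a common edge on one side, so `κ = #{U ∈ A∩B : s\U ∉ A∪B} ≥ #s + 1`. [this work] -/
theorem card_add_one_le_kap_of_triangle (h𝒳 : IsUpperSet (𝒳 : Set (Finset α))) (h𝒵 : IsUpperSet (𝒵 : Set (Finset α)))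
    (hX2 : ∀ U ∈ 𝒳, 2 ≤ #U) (hZ2 : ∀ U ∈ 𝒵, 2 ≤ #U) {x y z : α} (hx : x ∈ s) (hy : y ∈ s) (hz : z ∈ s)
    (hxy : ({x, y} : Finset α) ∈ 𝒳 ∩ 𝒵) (hyz : ({y, z} : Finset α) ∈ 𝒳 ∩ 𝒵) (hxz : ({x, z} : Finset α) ∈ 𝒳 ∩ 𝒵)
    (hxy' : x ≠ y) (hyz' : y ≠ z) (hxz' : x ≠ z) :
    (#s : ℤ) + 1 ≤ kap 𝒳 𝒵 ∅ s := by
  -- a subset of s containing two of x,y,z lies in both families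
  have two_in : ∀ (U : Finset α), U ⊆ s → ∀ (a b : α), a ≠ b → a ∈ U → b ∈ U → ({a, b} : Finset α) ∈ 𝒳 ∩ 𝒵 →
      U ∈ tr 𝒳 ∅ s ∩ tr 𝒵 ∅ s := by
    intro U hUs a b _ ha hb hab
    have hsub : ({a, b} : Finset α) ⊆ U := insert_subset ha (singleton_subset_iff.2 hb)
    exact mem_inter.2 ⟨mem_tr_empty.2 ⟨hUs, h𝒳 hsub (mem_inter.1 hab).1⟩, mem_tr_empty.2 ⟨hUs, h𝒵 hsub (mem_inter.1 hab).2⟩⟩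
  rw [kap_eq_pairs]
  -- no negative pairs
  have hneg : ((tr 𝒳 ∅ s \ tr 𝒵 ∅ s).filter fun U => s \ U ∈ tr 𝒵 ∅ s ∧ s \ U ∉ tr 𝒳 ∅ s) = ∅ := by
    refine filter_eq_empty_iff.2 fun U hU h => ?_
    obtain ⟨hUX, hUZ⟩ := mem_sdiff.1 hU
    have hUs := subset_of_mem_tr hUX
    -- two of x, y, z on the same side
    by_cases hxU : x ∈ U
    · by_cases hyU : y ∈ U
      · exact hUZ (mem_inter.1 (two_in U hUs x y hxy' hxU hyU hxy)).2
      · by_cases hzU : z ∈ U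
        · exact hUZ (mem_inter.1 (two_in U hUs x z hxz' hxU hzU hxz)).2
        · exact h.2 (mem_inter.1 (two_in (s \ U) sdiff_subset y z hyz' (mem_sdiff.2 ⟨hy, hyU⟩) (mem_sdiff.2 ⟨hz, hzU⟩) hyz)).1
    · by_cases hyU : y ∈ U
      · by_cases hzU : z ∈ U
        · exact hUZ (mem_inter.1 (two_in U hUs y z hyz' hyU hzU hyz)).2
        · exact h.2 (mem_inter.1 (two_in (s \ U) sdiff_subset x z hxz' (mem_sdiff.2 ⟨hx, hxU⟩) (mem_sdiff.2 ⟨hz, hzU⟩) hxz)).1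
      · exact h.2 (mem_inter.1 (two_in (s \ U) sdiff_subset x y hxy' (mem_sdiff.2 ⟨hx, hxU⟩) (mem_sdiff.2 ⟨hy, hyU⟩) hxy)).1
  rw [hneg, card_empty, Nat.cast_zero, sub_zero]
  -- positive pairs: s \ R for every R ⊆ s with #R ≤ 1
  have hsrc : #(s.powerset.filter fun R => #R ≤ 1) = #s + 1 := by
    have : (s.powerset.filter fun R => #R ≤ 1) = s.powersetCard 0 ∪ s.powersetCard 1 := by
      ext R; simp only [mem_filter, mem_powerset, mem_union, mem_powersetCard]
      constructor
      · rintro ⟨h1, h2⟩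
        rcases Nat.lt_or_ge (#R) 1 with h | h
        · exact Or.inl ⟨h1, by omega⟩
        · exact Or.inr ⟨h1, by omega⟩
      · rintro (⟨h1, h2⟩ | ⟨h1, h2⟩) <;> exact ⟨h1, by omega⟩
    rw [this, card_union_of_disjoint (by
      rw [Finset.disjoint_left]; intro R h0 h1
      have := (mem_powersetCard.1 h0).2; have := (mem_powersetCard.1 h1).2; omega),
      card_powersetCard, card_powersetCard, Nat.choose_zero_right, Nat.choose_one_right]; ring
  have hinj : Set.InjOn (fun R => s \ R) ↑(s.powerset.filter fun R => #R ≤ 1) := by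
    intro R hR R' hR' h
    have h1 : R ⊆ s := mem_powerset.1 (mem_filter.1 (Finset.mem_coe.1 hR)).1
    have h2 : R' ⊆ s := mem_powerset.1 (mem_filter.1 (Finset.mem_coe.1 hR')).1
    have := congrArg (fun T => s \ T) h
    simpa only [Finset.sdiff_sdiff_eq_self h1, Finset.sdiff_sdiff_eq_self h2] using this
  have hle := card_le_card_of_injOn (fun R => s \ R) (fun R hR => ?_) hinj
    (s := s.powerset.filter fun R => #R ≤ 1)
    (t := (tr 𝒳 ∅ s ∩ tr 𝒵 ∅ s).filter fun U => s \ U ∉ tr 𝒳 ∅ s ∧ s \ U ∉ tr 𝒵 ∅ s)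
  · rw [hsrc] at hle; exact_mod_cast hle
  -- the map lands in the positive pairs
  obtain ⟨hRs, hR1⟩ := mem_filter.1 hR
  have hRs' : R ⊆ s := mem_powerset.1 hRs
  refine mem_filter.2 ⟨?_, ?_, ?_⟩
  · -- s \ R contains two of x, y, z
    have hcnt : 2 ≤ #(({x, y, z} : Finset α) \ R) := by
      have h3 : #({x, y, z} : Finset α) = 3 := by
        rw [card_insert_of_notMem (by simp [hxy', hxz']), card_pair hyz']
      have := le_card_sdiff R ({x, y, z} : Finset α)  -- #t - #s ≤ #(t \ s)
      omega
    obtain ⟨a, b, ha, hb, hab⟩ := one_lt_card_iff.1 hcnt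
    have ha' := mem_sdiff.1 ha; have hb' := mem_sdiff.1 hb
    have hmem : ∀ c, c ∈ ({x, y, z} : Finset α) → c ∈ s := by
      intro c hc; simp only [mem_insert, mem_singleton] at hc; rcases hc with rfl | rfl | rfl <;> assumption
    have key : ({a, b} : Finset α) ∈ 𝒳 ∩ 𝒵 := by
      have hxyz : ∀ c d : α, c ∈ ({x, y, z} : Finset α) → d ∈ ({x, y, z} : Finset α) → c ≠ d → ({c, d} : Finset α) ∈ 𝒳 ∩ 𝒵 := by
        intro c d hc hd hcd
        simp only [mem_insert, mem_singleton] at hc hd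
        rcases hc with rfl | rfl | rfl <;> rcases hd with rfl | rfl | rfl <;>
          first | exact absurd rfl hcd | assumption | (rw [pair_comm]; assumption)
      exact hxyz a b ha'.1 hb'.1 hab
    exact two_in (s \ R) sdiff_subset a b hab (mem_sdiff.2 ⟨hmem a ha'.1, ha'.2⟩) (mem_sdiff.2 ⟨hmem b hb'.1, hb'.2⟩) key
  · rw [Finset.sdiff_sdiff_eq_self hRs']; exact fun h => by have := hX2 R (mem_tr_empty.1 h).2; omega
  · rw [Finset.sdiff_sdiff_eq_self hRs']; exact fun h => by have := hZ2 R (mem_tr_empty.1 h).2; omega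

end TwoLive

section Degree
variable {𝒳 𝒵 : Finset (Finset α)} {s : Finset α} {v : α}

/-- Sets of size ≤ 1 are never in the (empty-base) trace of a 2-live family. [this work] -/
theorem notMem_tr_empty_of_card_le_one (hX2 : ∀ U ∈ 𝒳, 2 ≤ #U) {R : Finset α} (hR : #R ≤ 1) : R ∉ tr 𝒳 ∅ s :=
  fun h => by have := hX2 R (mem_tr_empty.1 h).2; omega

/-- If `v` is commonly adjacent to every point of `s'`, every nonempty `R ⊆ s'` lies in the trace with base `{v}`. [this work] -/
theorem mem_tr_singleton_of_nonempty (h𝒳 : IsUpperSet (𝒳 : Set (Finset α))) {s' : Finset α}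
    (hall : ∀ u ∈ s', ({v, u} : Finset α) ∈ 𝒳) {R : Finset α} (hR : R ⊆ s') (hne : R.Nonempty) : R ∈ tr 𝒳 {v} s' := by
  obtain ⟨u, hu⟩ := hne
  refine mem_tr.2 ⟨hR, h𝒳 ?_ (hall u (hR hu))⟩
  intro x hx; simp only [mem_insert, mem_singleton] at hx
  rcases hx with rfl | rfl
  · exact mem_union_left _ (mem_singleton_self _)
  · exact mem_union_right _ hu

/-- Membership in `cnbrs`. [this work] -/
theorem mem_cnbrs {u : α} : u ∈ cnbrs 𝒳 𝒵 s v ↔ (u ∈ s ∧ u ≠ v) ∧ ({v, u} : Finset α) ∈ 𝒳 ∧ ({v, u} : Finset α) ∈ 𝒵 := by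
  unfold cnbrs; rw [mem_filter, mem_erase]; tauto

/-- The core of the DEGREE lemma: if `v ∈ s` is commonly adjacent to ALL other points of `s` and `#s ≥ 4`, then `κ(∅, s) ≥ #s`. [this work] -/
theorem card_le_kap_of_adjacent_all (h𝒳 : IsUpperSet (𝒳 : Set (Finset α))) (h𝒵 : IsUpperSet (𝒵 : Set (Finset α)))
    (hX2 : ∀ U ∈ 𝒳, 2 ≤ #U) (hZ2 : ∀ U ∈ 𝒵, 2 ≤ #U) (hv : v ∈ s) (hs : 4 ≤ #s)
    (hall : ∀ u ∈ s.erase v, ({v, u} : Finset α) ∈ 𝒳 ∧ ({v, u} : Finset α) ∈ 𝒵) :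
    (#s : ℤ) ≤ kap 𝒳 𝒵 ∅ s := by
  have hrec := kap_rec (𝒳 := 𝒳) (𝒵 := 𝒵) h𝒳 h𝒵 hv (notMem_empty v)
  rw [insert_empty] at hrec
  set s' := s.erase v with hs'
  have hs'card : #s' = #s - 1 := card_erase_of_mem hv
  have hs'3 : 3 ≤ #s' := by omega
  -- the link cube ({v}, s') has a common loop: κ ≥ 1
  obtain ⟨u, hu⟩ : s'.Nonempty := card_pos.1 (by omega)
  have hloop : 1 ≤ kap 𝒳 𝒵 {v} s' := by
    have h1 := hall u hu
    rw [pair_comm] at h1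
    have hvX : ({v} : Finset α) ∉ 𝒳 := fun h => by have := hX2 _ h; simp at this
    have hvZ : ({v} : Finset α) ∉ 𝒵 := fun h => by have := hZ2 _ h; simp at this
    exact one_le_kap_of_loop h𝒳 h𝒵 hvX hvZ hu h1.1 h1.2
  -- names for the traces on the deletion cube (∅, s') and the link cube ({v}, s')
  set A0 := tr 𝒳 ∅ s' with hA0
  set B0 := tr 𝒵 ∅ s' with hB0
  set A1 := tr 𝒳 {v} s' with hA1
  set B1 := tr 𝒵 {v} s' with hB1
  have hA1ne : ∀ R, R ⊆ s' → R.Nonempty → R ∈ A1 := fun R hR hne =>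
    mem_tr_singleton_of_nonempty h𝒳 (fun u hu => (hall u hu).1) hR hne
  have hB1ne : ∀ R, R ⊆ s' → R.Nonempty → R ∈ B1 := fun R hR hne =>
    mem_tr_singleton_of_nonempty h𝒵 (fun u hu => (hall u hu).2) hR hne
  have hA0two : ∀ R ∈ A0, 2 ≤ #R := fun R hR => hX2 R (mem_tr_empty.1 hR).2
  have hB0two : ∀ R ∈ B0, 2 ≤ #R := fun R hR => hZ2 R (mem_tr_empty.1 hR).2
  have hsd1 : ∀ x ∈ s', s' \ {x} = s'.erase x := fun x _ => sdiff_singleton_eq_erase x s'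
  have hsd2 : ∀ x ∈ s', s' \ s'.erase x = {x} := fun x hx => by
    ext y; simp only [mem_sdiff, mem_erase, mem_singleton, not_and]
    constructor
    · rintro ⟨hy, h⟩; by_contra hne; exact h hne hy
    · rintro rfl; exact ⟨hx, fun h _ => (h rfl).elim⟩
  have herase_ne : ∀ x ∈ s', (s'.erase x).Nonempty := fun x hx => card_pos.1 (by rw [card_erase_of_mem hx]; omega)
  -- pair formula for κ(∅, s')
  have hpair := kap_eq_pairs (𝒳 := 𝒳) (𝒵 := 𝒵) (D := ∅) (s := s')
  rw [← hA0, ← hB0] at hpair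
  set P := (A0 ∩ B0).filter fun U => s' \ U ∉ A0 ∧ s' \ U ∉ B0 with hP
  set Q := (A0 \ B0).filter fun U => s' \ U ∈ B0 ∧ s' \ U ∉ A0 with hQ
  set C := (A1 \ A0).filter fun R => s' \ R ∈ B1 ∧ s' \ R ∉ B0 with hC
  -- three kinds of points of s'
  set Na := s'.filter fun x => s'.erase x ∈ A0 ∧ s'.erase x ∈ B0 with hNa
  set Nb := s'.filter fun x => s'.erase x ∉ B0 with hNb
  set Nc := s'.filter fun x => s'.erase x ∈ B0 ∧ s'.erase x ∉ A0 with hNc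
  have hsplit : #s' = #Na + #Nb + #Nc := by
    have e1 := card_filter_add_card_filter_not (s := s') (fun x => s'.erase x ∈ B0)
    change #(s'.filter fun x => s'.erase x ∈ B0) + #Nb = #s' at e1
    have e2 := card_filter_add_card_filter_not (s := s'.filter fun x => s'.erase x ∈ B0) (fun x => s'.erase x ∈ A0)
    have ea : (s'.filter fun x => s'.erase x ∈ B0).filter (fun x => s'.erase x ∈ A0) = Na := by
      rw [hNa, filter_filter]; congr 1; ext x; tauto
    have ec : (s'.filter fun x => s'.erase x ∈ B0).filter (fun x => ¬ s'.erase x ∈ A0) = Nc := by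
      rw [hNc, filter_filter]
    rw [ea, ec] at e2
    omega
  -- (a) Na ↪ P via x ↦ s' − x
  have ha : #Na ≤ #P := by
    refine card_le_card_of_injOn (fun x => s'.erase x) (fun x hx => ?_) (fun x hx y hy h => ?_)
    · obtain ⟨hxs, hxA, hxB⟩ := mem_filter.1 (Finset.mem_coe.1 hx)
      refine Finset.mem_coe.2 (mem_filter.2 ⟨mem_inter.2 ⟨hxA, hxB⟩, ?_, ?_⟩) <;> rw [hsd2 x hxs]
      · exact notMem_tr_empty_of_card_le_one hX2 (by simp)
      · exact notMem_tr_empty_of_card_le_one hZ2 (by simp)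
    · have hxs := (mem_filter.1 (Finset.mem_coe.1 hx)).1
      have hys := (mem_filter.1 (Finset.mem_coe.1 hy)).1
      have := congrArg (fun T => s' \ T) h
      simp only [hsd2 x hxs, hsd2 y hys] at this
      exact singleton_injective this
  -- (b) three disjoint families inside C
  have hb1 : ∀ x ∈ Nb, ({x} : Finset α) ∈ C := fun x hx => by
    obtain ⟨hxs, hxB⟩ := mem_filter.1 hx
    refine mem_filter.2 ⟨mem_sdiff.2 ⟨hA1ne {x} (singleton_subset_iff.2 hxs) (singleton_nonempty x),
      notMem_tr_empty_of_card_le_one hX2 (by simp)⟩, ?_, ?_⟩ <;> rw [hsd1 x hxs]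
    · exact hB1ne _ (erase_subset x s') (herase_ne x hxs)
    · exact hxB
  have hb2 : ∀ x ∈ Nc, s'.erase x ∈ C := fun x hx => by
    obtain ⟨hxs, hxB, hxA⟩ := mem_filter.1 hx
    refine mem_filter.2 ⟨mem_sdiff.2 ⟨hA1ne _ (erase_subset x s') (herase_ne x hxs), hxA⟩, ?_, ?_⟩ <;> rw [hsd2 x hxs]
    · exact hB1ne {x} (singleton_subset_iff.2 hxs) (singleton_nonempty x)
    · exact notMem_tr_empty_of_card_le_one hZ2 (by simp)
  have hb3 : ∀ U ∈ Q, s' \ U ∈ C := fun U hU => by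
    obtain ⟨hUAB, hUB, hUA⟩ := mem_filter.1 hU
    obtain ⟨hUA0, hUB0⟩ := mem_sdiff.1 hUAB
    have hUs : U ⊆ s' := subset_of_mem_tr hUA0
    refine mem_filter.2 ⟨mem_sdiff.2 ⟨hA1ne _ sdiff_subset ?_, hUA⟩, ?_, ?_⟩
    · exact card_pos.1 (by have := hB0two _ hUB; omega)
    · rw [Finset.sdiff_sdiff_eq_self hUs]; exact hB1ne U hUs (card_pos.1 (by have := hA0two U hUA0; omega))
    · rw [Finset.sdiff_sdiff_eq_self hUs]; exact hUB0
  -- cardinalities of the three image families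
  have hcard1 : ∀ R ∈ Nb.image fun x => ({x} : Finset α), #R = 1 := fun R hR => by
    obtain ⟨x, _, rfl⟩ := mem_image.1 hR; exact card_singleton x
  have hcard2 : ∀ R ∈ Nc.image fun x => s'.erase x, #R = #s' - 1 := fun R hR => by
    obtain ⟨x, hx, rfl⟩ := mem_image.1 hR; exact card_erase_of_mem (mem_filter.1 hx).1
  have hcard3 : ∀ R ∈ Q.image fun U => s' \ U, 2 ≤ #R ∧ #R + 2 ≤ #s' := fun R hR => by
    obtain ⟨U, hU, rfl⟩ := mem_image.1 hR
    obtain ⟨hUAB, hUB, _⟩ := mem_filter.1 hU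
    have hUA0 := (mem_sdiff.1 hUAB).1
    have hUs : U ⊆ s' := subset_of_mem_tr hUA0
    have e : #(s' \ U) = #s' - #U := card_sdiff_of_subset hUs
    have h1 := hA0two U hUA0; have h2 := hB0two _ hUB
    have h3 : #U ≤ #s' := card_le_card hUs
    omega
  have hdisj12 : Disjoint (Nb.image fun x => ({x} : Finset α)) (Nc.image fun x => s'.erase x) :=
    Finset.disjoint_left.2 fun R h1 h2 => by have := hcard1 R h1; have := hcard2 R h2; omega
  have hdisj3 : Disjoint (Nb.image (fun x => ({x} : Finset α)) ∪ Nc.image (fun x => s'.erase x)) (Q.image fun U => s' \ U) :=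
    Finset.disjoint_left.2 fun R h12 h3 => by
      have h3' := hcard3 R h3
      rcases mem_union.1 h12 with h1 | h2
      · have := hcard1 R h1; omega
      · have := hcard2 R h2; omega
  have hsub : Nb.image (fun x => ({x} : Finset α)) ∪ Nc.image (fun x => s'.erase x) ∪ Q.image (fun U => s' \ U) ⊆ C := by
    intro R hR
    rcases mem_union.1 hR with h12 | h3
    · rcases mem_union.1 h12 with h1 | h2
      · obtain ⟨x, hx, rfl⟩ := mem_image.1 h1; exact hb1 x hx
      · obtain ⟨x, hx, rfl⟩ := mem_image.1 h2; exact hb2 x hx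
    · obtain ⟨U, hU, rfl⟩ := mem_image.1 h3; exact hb3 U hU
  have hinj1 : #(Nb.image fun x => ({x} : Finset α)) = #Nb := card_image_of_injective _ singleton_injective
  have hinj2 : #(Nc.image fun x => s'.erase x) = #Nc :=
    card_image_of_injOn fun x hx y hy h => by
      have hxs := (mem_filter.1 (Finset.mem_coe.1 hx)).1
      have hys := (mem_filter.1 (Finset.mem_coe.1 hy)).1
      have := congrArg (fun T => s' \ T) h
      simp only [hsd2 x hxs, hsd2 y hys] at this
      exact singleton_injective this
  have hinj3 : #(Q.image fun U => s' \ U) = #Q :=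
    card_image_of_injOn fun U hU U' hU' h => by
      have h1 : U ⊆ s' := subset_of_mem_tr (mem_sdiff.1 (mem_filter.1 (Finset.mem_coe.1 hU)).1).1
      have h2 : U' ⊆ s' := subset_of_mem_tr (mem_sdiff.1 (mem_filter.1 (Finset.mem_coe.1 hU')).1).1
      have := congrArg (fun T => s' \ T) h
      simpa only [Finset.sdiff_sdiff_eq_self h1, Finset.sdiff_sdiff_eq_self h2] using this
  have hb : #Nb + #Nc + #Q ≤ #C := by
    have := card_le_card hsub
    rw [card_union_of_disjoint hdisj3, card_union_of_disjoint hdisj12, hinj1, hinj2, hinj3] at this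
    exact this
  -- assemble
  have hC0 : kap 𝒳 𝒵 ∅ s = kap 𝒳 𝒵 ∅ s' + kap 𝒳 𝒵 {v} s' + #C := hrec
  rw [hC0, hpair]
  have : (#s : ℤ) = #s' + 1 := by rw [hs'card, Nat.cast_sub (by omega), Nat.cast_one]; ring
  rw [this]
  push_cast [hsplit]
  have ha' : (#Na : ℤ) ≤ #P := by exact_mod_cast ha
  have hb' : (#Nb : ℤ) + #Nc + #Q ≤ #C := by exact_mod_cast hb
  linarith

/-- On three points: `κ ≥ #(common neighbours of v) + 1`, the common members `{v,u}` and `s` itself. [this work] -/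
theorem card_cnbrs_add_one_le_kap_three (h𝒳 : IsUpperSet (𝒳 : Set (Finset α))) (h𝒵 : IsUpperSet (𝒵 : Set (Finset α)))
    (hX2 : ∀ U ∈ 𝒳, 2 ≤ #U) (hZ2 : ∀ U ∈ 𝒵, 2 ≤ #U) (hv : v ∈ s) (hs : #s = 3) (hN : (cnbrs 𝒳 𝒵 s v).Nonempty) :
    (#(cnbrs 𝒳 𝒵 s v) : ℤ) + 1 ≤ kap 𝒳 𝒵 ∅ s := by
  rw [kap_empty_eq_card_of_card_le_three hX2 hZ2 hs.le]
  -- the common members {v,u} (u a common neighbour) and s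
  have himg : (cnbrs 𝒳 𝒵 s v).image (fun u => ({v, u} : Finset α)) ⊆ tr 𝒳 ∅ s ∩ tr 𝒵 ∅ s := fun e he => by
    obtain ⟨u, hu, rfl⟩ := mem_image.1 he
    obtain ⟨⟨hus, _⟩, huX, huZ⟩ := mem_cnbrs.1 hu
    have hsub : ({v, u} : Finset α) ⊆ s := insert_subset hv (singleton_subset_iff.2 hus)
    exact mem_inter.2 ⟨mem_tr_empty.2 ⟨hsub, huX⟩, mem_tr_empty.2 ⟨hsub, huZ⟩⟩
  have hinj : #((cnbrs 𝒳 𝒵 s v).image fun u => ({v, u} : Finset α)) = #(cnbrs 𝒳 𝒵 s v) :=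
    card_image_of_injOn fun u hu u' hu' h => by
      have hne : u ≠ v := (mem_cnbrs.1 (Finset.mem_coe.1 hu)).1.2
      have : u ∈ ({v, u'} : Finset α) := by rw [← h]; simp
      simp only [mem_insert, mem_singleton] at this
      rcases this with h1 | h1
      · exact absurd h1 hne
      · exact h1
  obtain ⟨u, hu⟩ := hN
  obtain ⟨⟨hus, huv⟩, huX, huZ⟩ := mem_cnbrs.1 hu
  have hsmem : s ∈ tr 𝒳 ∅ s ∩ tr 𝒵 ∅ s := by
    have hsub : ({v, u} : Finset α) ⊆ s := insert_subset hv (singleton_subset_iff.2 hus)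
    exact mem_inter.2 ⟨mem_tr_empty.2 ⟨Subset.rfl, h𝒳 hsub huX⟩, mem_tr_empty.2 ⟨Subset.rfl, h𝒵 hsub huZ⟩⟩
  have hsnot : s ∉ (cnbrs 𝒳 𝒵 s v).image fun u => ({v, u} : Finset α) := fun h => by
    obtain ⟨u', hu', he⟩ := mem_image.1 h
    have hne : v ≠ u' := fun h => (mem_cnbrs.1 hu').1.2 h.symm
    have : #s = 2 := by rw [← he]; exact card_pair hne
    omega
  have := card_le_card (insert_subset hsmem himg)
  rw [card_insert_of_notMem hsnot, hinj] at this
  exact_mod_cast this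

/-- **DEGREE lemma**: for 2-live up-sets on `#s ≥ 3` points, `κ(∅,s) ≥ 1 + #(common neighbours of v in s)` whenever `v` has a common neighbour.
[this work] -/
theorem card_cnbrs_add_one_le_kap (h𝒳 : IsUpperSet (𝒳 : Set (Finset α))) (h𝒵 : IsUpperSet (𝒵 : Set (Finset α)))
    (hX2 : ∀ U ∈ 𝒳, 2 ≤ #U) (hZ2 : ∀ U ∈ 𝒵, 2 ≤ #U) :
    ∀ (n : ℕ) (s : Finset α) (v : α), #s = n → 3 ≤ #s → v ∈ s → (cnbrs 𝒳 𝒵 s v).Nonempty →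
      (#(cnbrs 𝒳 𝒵 s v) : ℤ) + 1 ≤ kap 𝒳 𝒵 ∅ s := by
  intro n
  induction n using Nat.strong_induction_on with
  | _ n ih =>
  intro s v hsn hs3 hv hN
  by_cases h3 : #s = 3
  · exact card_cnbrs_add_one_le_kap_three h𝒳 h𝒵 hX2 hZ2 hv h3 hN
  have hs4 : 4 ≤ #s := by omega
  by_cases hx : ∃ x ∈ s.erase v, x ∉ cnbrs 𝒳 𝒵 s v
  · obtain ⟨x, hx, hxN⟩ := hx
    have hxs : x ∈ s := mem_of_mem_erase hx
    have hxv : x ≠ v := ne_of_mem_erase hx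
    -- delete x: κ does not increase, the common neighbourhood of v is unchanged
    have hle := kap_erase_le (𝒳 := 𝒳) (𝒵 := 𝒵) (D := ∅) h𝒳 h𝒵 (disjoint_empty_left s) hxs
    have hN' : cnbrs 𝒳 𝒵 (s.erase x) v = cnbrs 𝒳 𝒵 s v := by
      ext u; simp only [mem_cnbrs, mem_erase]
      constructor
      · rintro ⟨⟨⟨_, hus⟩, huv⟩, hX, hZ⟩; exact ⟨⟨hus, huv⟩, hX, hZ⟩
      · rintro ⟨⟨hus, huv⟩, hX, hZ⟩
        refine ⟨⟨⟨fun h => hxN ?_, hus⟩, huv⟩, hX, hZ⟩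
        subst h; exact mem_cnbrs.2 ⟨⟨hus, huv⟩, hX, hZ⟩
    have hcard : #(s.erase x) = n - 1 := by rw [card_erase_of_mem hxs, hsn]
    have := ih (n - 1) (by omega) (s.erase x) v hcard (by omega) (mem_erase.2 ⟨hxv.symm, hv⟩) (by rw [hN']; exact hN)
    rw [hN'] at this
    exact this.trans hle
  · -- every other point is a common neighbour of v
    push Not at hx
    have hall : ∀ u ∈ s.erase v, ({v, u} : Finset α) ∈ 𝒳 ∧ ({v, u} : Finset α) ∈ 𝒵 := fun u hu =>
      (mem_cnbrs.1 (hx u hu)).2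
    have hNeq : cnbrs 𝒳 𝒵 s v = s.erase v := by
      refine Subset.antisymm (filter_subset _ _) fun u hu => hx u hu
    rw [hNeq, card_erase_of_mem hv]
    have := card_le_kap_of_adjacent_all h𝒳 h𝒵 hX2 hZ2 hv hs4 hall
    have h1 : 1 ≤ #s := by omega
    rw [Nat.cast_sub h1, Nat.cast_one]; linarith

end Degree

end Summit.CriticalPhenomena.PercolationContinuityZ3.Theorems.SahiCTCForms
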